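import Summits.QuantumAdvantage.QuantumAdvantage.Theorems.MobiusLadderLiouvilleOrthogonalTC0TransferFixed
import Summits.QuantumAdvantage.QuantumAdvantage.Theorems.MobiusLadderLiouvilleOrthogonalTC0StubDilate
import Summits.QuantumAdvantage.QuantumAdvantage.Theorems.MobiusLadderLiouvilleOrthogonalTC0StubHardcore
import Summits.QuantumAdvantage.QuantumAdvantage.Theorems.MobiusLadderLiouvilleOrthogonalTC0StubPieces
import Summits.QuantumAdvantage.QuantumAdvantage.Theorems.MobiusLadderLiouvilleOrthogonalTC0StubLevels
import HarnessLib

/-!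
# Crux `MobiusLadder.LiouvilleOrthogonalTC0` (stmt-QuantumAdvantage-1393), line `Sketch`: the transfer,
part 3 — `stub_transfer`

The line's theorem (registered stub `stub_transfer` of the checked skeleton
`Cruxes/LiouvilleOrthogonalTC0/Lines/Sketch.lean`): constant-error hardness of `Ω mod 2` on
prime-window pieces at every scale exponent, `∀ A, LocalPieceHardness δ₀ κ Λ₀ A` (the OPEN
hypothesis `stub_hyp`), implies Möbius randomness for `TC⁰`,
`Summit.QuantumAdvantage.QuantumAdvantage.Theses.MobiusLadder.LiouvilleOrthogonalTC0` — "at rung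
R2 the `∀ε`-law is free given constant-error hardness" (card `multiplicative-xor-ladder`).
Parameters: `ε' = min ε 1`, `δ = min δ₀ ½`, `k₁` with `(1-δ)^k₁ ≤ ε'/8`, `k = 2k₁`,
`θ = γ = ε'/(8k)`, cap `K = ⌈2/(θδ)⌉`, dilation `(D, q)` from `stub_dilate`, hardness at depth
`d + D + 1` and size `K²(p + q + 1) + 1`, `L₀ = 64/ε'`, levels and `A` from `stub_levels`; then
`transfer_fixed` (part 2) with measures from `LocalPieceHardness` + `stub_hardcore`, `#Bad` from
`stub_pieces` (Turán–Kubilius), thin pieces from `stub_thin`, and `o(2ⁿ)` bookkeeping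
(`TransferEv.*`).
-/

set_option linter.dupNamespace false -- D-0017: single-problem summit ⇒ `QuantumAdvantage.QuantumAdvantage` by design

noncomputable section

namespace Summit.QuantumAdvantage.QuantumAdvantage.Theorems.LiouvilleOrthogonalTC0

open Filter Finset
open Literature.Computability.Complexity
open Literature.Probability.RandomGraphs.LowDegree (sgn)
open Summit.QuantumAdvantage.QuantumAdvantage.Theses.MobiusLadder (LiouvilleOrthogonalTC0)

namespace TransferEv


/-- `C·(n+2)·2^(a n) ≤ 2ⁿ` eventually, for `a < 1`. -/
theorem ev_small (C a : ℝ) (ha : a < 1) :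
    ∀ᶠ n : ℕ in atTop, C * ((n : ℝ) + 2) * (2 : ℝ) ^ (a * n) ≤ (2 : ℝ) ^ n := by
  -- `r = 2^(a-1) < 1`, `(n+2) rⁿ → 0`
  set r : ℝ := (2 : ℝ) ^ (a - 1) with hr
  have hr0 : 0 < r := Real.rpow_pos_of_pos (by norm_num) _
  have hr1 : r < 1 := by
    rw [hr]; exact Real.rpow_lt_one_of_one_lt_of_neg (by norm_num) (by linarith)
  have h1 : Tendsto (fun n : ℕ => (n : ℝ) * r ^ n) atTop (nhds 0) :=
    tendsto_self_mul_const_pow_of_lt_one hr0.le hr1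
  have h2 : Tendsto (fun n : ℕ => (2 : ℝ) * r ^ n) atTop (nhds 0) := by
    have := (tendsto_pow_atTop_nhds_zero_of_lt_one hr0.le hr1).const_mul (2 : ℝ)
    simpa using this
  have h3 : Tendsto (fun n : ℕ => ((n : ℝ) + 2) * r ^ n) atTop (nhds 0) := by
    have := h1.add h2
    simp only [add_zero] at this
    refine this.congr fun n => by ring
  have hε : (0 : ℝ) < 1 / (|C| + 1) := by positivity
  have h4 := h3.eventually (gt_mem_nhds hε)
  filter_upwards [h4] with n hn
  have hrn : r ^ n * (2 : ℝ) ^ n = (2 : ℝ) ^ (a * n) := by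
    rw [hr, ← Real.rpow_natCast ((2 : ℝ) ^ (a - 1)) n, ← Real.rpow_mul (by norm_num),
      ← Real.rpow_natCast (2 : ℝ) n, ← Real.rpow_add (by norm_num)]
    congr 1; ring
  have hpos : (0 : ℝ) ≤ ((n : ℝ) + 2) * r ^ n := by positivity
  have hC : C ≤ |C| := le_abs_self C
  have h2n : (0 : ℝ) < (2 : ℝ) ^ n := by positivity
  calc C * ((n : ℝ) + 2) * (2 : ℝ) ^ (a * n) = C * (((n : ℝ) + 2) * r ^ n) * (2 : ℝ) ^ n := by
        rw [← hrn]; ring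
    _ ≤ |C| * (1 / (|C| + 1)) * (2 : ℝ) ^ n := by
        apply mul_le_mul_of_nonneg_right _ h2n.le
        exact mul_le_mul hC hn.le hpos (abs_nonneg C)
    _ ≤ 1 * (2 : ℝ) ^ n := by
        apply mul_le_mul_of_nonneg_right _ h2n.le
        rw [mul_one_div, div_le_one (by positivity)]; linarith [abs_nonneg C]
    _ = (2 : ℝ) ^ n := one_mul _

/-- `2^(n/A) → ∞`: eventually `C ≤ 2^(n/A)`. -/
theorem ev_T_large (A : ℕ) (hA : 1 ≤ A) (C : ℝ) :
    ∀ᶠ n : ℕ in atTop, C ≤ (2 : ℝ) ^ ((n : ℝ) / (A : ℝ)) := by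
  have hA0 : (0 : ℝ) < A := by exact_mod_cast hA
  set r : ℝ := (2 : ℝ) ^ ((1 : ℝ) / A) with hr
  have hr1 : 1 < r := Real.one_lt_rpow (by norm_num) (by positivity)
  have ht := tendsto_pow_atTop_atTop_of_one_lt hr1
  filter_upwards [ht.eventually_ge_atTop C] with n hn
  have : r ^ n = (2 : ℝ) ^ ((n : ℝ) / (A : ℝ)) := by
    rw [hr, ← Real.rpow_natCast, ← Real.rpow_mul (by norm_num)]
    congr 1; field_simp
  rwa [this] at hn

/-- `n^(-A) ≤ θ` eventually (`A ≥ 1`, `θ > 0`). -/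
theorem ev_rpow_neg_le (A : ℕ) (hA : 1 ≤ A) (θ : ℝ) (hθ : 0 < θ) :
    ∀ᶠ n : ℕ in atTop, (n : ℝ) ^ (-(A : ℝ)) ≤ θ := by
  filter_upwards [Filter.eventually_ge_atTop ⌈1 / θ⌉₊, Filter.eventually_ge_atTop 1] with n hn hn1
  have hn1' : (1 : ℝ) ≤ n := by exact_mod_cast hn1
  have hA' : -(A : ℝ) ≤ -1 := by
    have : (1 : ℝ) ≤ A := by exact_mod_cast hA
    linarith
  calc (n : ℝ) ^ (-(A : ℝ)) ≤ (n : ℝ) ^ (-1 : ℝ) := Real.rpow_le_rpow_of_exponent_le hn1' hA'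
    _ = 1 / n := by rw [Real.rpow_neg_one]; ring
    _ ≤ θ := by
        rw [div_le_iff₀ (by linarith)]
        have h1 : (⌈1 / θ⌉₊ : ℝ) ≤ n := by exact_mod_cast hn
        have h2 : 1 / θ ≤ ⌈1 / θ⌉₊ := Nat.le_ceil _
        have h3 : 1 / θ * θ = 1 := by field_simp
        nlinarith

/-- `1 ≤ c·2ⁿ` eventually (`c > 0`). -/
theorem ev_one_le (c : ℝ) (hc : 0 < c) : ∀ᶠ n : ℕ in atTop, 1 ≤ c * (2 : ℝ) ^ n := by
  have ht := tendsto_pow_atTop_atTop_of_one_lt (show (1 : ℝ) < 2 by norm_num)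
  filter_upwards [ht.eventually_ge_atTop (1 / c)] with n hn
  rw [div_le_iff₀ hc] at hn
  linarith [mul_comm c ((2 : ℝ) ^ n)]

end TransferEv

open Transfer TransferEv in
/-- **The transfer** (the line's theorem): constant-error hardness of `Ω mod 2` on prime-window
pieces at every scale exponent (`∀ A, LocalPieceHardness δ₀ κ Λ₀ A`) implies Möbius randomness for
`TC⁰`, `LiouvilleOrthogonalTC0`. Parameters: `ε' = min ε 1`, `δ = min δ₀ ½`, `k₁` with
`(1-δ)^k₁ ≤ ε'/8`, `k = 2k₁`, `θ = γ = ε'/(8k)`, cap `K = ⌈2/(θδ)⌉`, dilation `(D, q)` from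
`stub_dilate`, hardness polynomial `K²(p + q + 1) + 1` at depth `d + D + 1`, `L₀ = 64/ε'`, levels and
`A` from `stub_levels`; then `transfer_fixed` with measures from `LocalPieceHardness` +
`stub_hardcore`, `#Bad` by `stub_pieces`, thin pieces by `stub_thin`. -/
theorem stub_transfer (δ₀ κ Λ₀ : ℝ) (hδ₀ : 0 < δ₀) (hκ : 0 < κ) (hΛ₀ : 1 ≤ Λ₀)
    (h : ∀ A : ℕ, LocalPieceHardness δ₀ κ Λ₀ A) : LiouvilleOrthogonalTC0 := by
  intro d p ε hε
  -- numerical parameters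
  set ε' : ℝ := min ε 1 with hε'
  have hε'0 : 0 < ε' := lt_min hε one_pos
  have hε'1 : ε' ≤ 1 := min_le_right _ _
  have hε'ε : ε' ≤ ε := min_le_left _ _
  set δ : ℝ := min δ₀ (1 / 2) with hδdef
  have hδ0 : 0 < δ := lt_min hδ₀ (by norm_num)
  have hδ1 : δ ≤ 1 := (min_le_right _ _).trans (by norm_num)
  have hδδ₀ : δ ≤ δ₀ := min_le_left _ _
  obtain ⟨m, hm⟩ := exists_pow_lt_of_lt_one (show 0 < ε' / 8 by positivity)
    (show 1 - δ < 1 by linarith)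
  set k₁ : ℕ := max m 1 with hk₁def
  have hk₁1 : 1 ≤ k₁ := le_max_right _ _
  have hpowk₁ : (1 - δ) ^ k₁ ≤ ε' / 8 :=
    (pow_le_pow_of_le_one (by linarith) (by linarith) (le_max_left _ _)).trans hm.le
  set k : ℕ := 2 * k₁ with hkdef
  have hk1 : 1 ≤ k := by omega
  have hk0 : (0 : ℝ) < k := by exact_mod_cast (show 0 < k by omega)
  have hk1r : (1 : ℝ) ≤ k := by exact_mod_cast hk1
  set θ : ℝ := ε' / (8 * k) with hθdef
  have hθ0 : 0 < θ := by positivity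
  have hkθ : (k : ℝ) * θ = ε' / 8 := by rw [hθdef]; field_simp
  have hθ1 : θ ≤ 1 := by
    rw [hθdef, div_le_one (by positivity)]; nlinarith
  have hlog : 0 < Real.log (1 + θ) := Real.log_pos (by linarith)
  set K : ℕ := ⌈2 / (θ * δ)⌉₊ with hKdef
  have hK : 2 ≤ K * θ * δ := by
    have h1 : 2 / (θ * δ) ≤ K := Nat.le_ceil _
    rw [div_le_iff₀ (by positivity)] at h1
    linarith
  -- dilation and the hardness polynomial
  obtain ⟨D, q, hDq⟩ := stub_dilate
  set p' : Polynomial ℕ := Polynomial.C (K ^ 2) * (p + q + 1) + 1 with hp'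
  have hp'eval : ∀ n, p'.eval n = K ^ 2 * (p.eval n + q.eval n + 1) + 1 := by
    intro n; simp [hp']
  -- levels
  set L₀ : ℝ := 64 / ε' with hL₀def
  have hL₀1 : 1 ≤ L₀ := by rw [hL₀def, le_div_iff₀ hε'0]; linarith
  obtain ⟨A, hA2, zf, hz⟩ := stub_levels k hk1 κ Λ₀ L₀ hκ hΛ₀ hL₀1
  have hA1 : 1 ≤ A := by omega
  -- the hypothesis at `(A, d + D + 1, p')`
  have hLPH := h A (d + D + 1) p'
  -- eventual facts
  have E3 := ev_rpow_neg_le A hA1 θ hθ0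
  have E4 := ev_one_le (ε' / 8) (by positivity)
  have E5 := ev_small (8 * 16 / ε') (2 / 3) (by norm_num)
  have E6a := ev_T_large A hA1 (32 * k / (ε' * θ))
  have E6b := ev_small (16 * k * (1 / Real.log (1 + θ) + 2) / ε') (1 / 2) (by norm_num)
  have E7 := ev_T_large A hA1 1
  filter_upwards [hz, hLPH, E3, E4, E5, E6a, E6b, E7] with n hzn hLn hE3 hE4 hE5 hE6a hE6b hE7
  obtain ⟨hmono, htopn, hlow, hwide, hheavy⟩ := hzn
  intro C hC hCd hCs
  -- the test and its dilates
  have hgReal : ACRealOver tcBasis C.eval d (p.eval n) := ACRealOver.of_circuit C hC hCd hCs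
  have hdil : ∀ R : ℕ, ACRealOver tcBasis
      (fun x : Fin n → Bool =>
        C.eval (fun i : Fin n => Nat.testBit ((∑ j : Fin n, (x j).toNat * 2 ^ (j : ℕ)) * R) i))
      (d + D) (p.eval n + q.eval n) := fun R => hDq n d (p.eval n) R C.eval hgReal
  -- data of the fixed-`n` estimate
  set T : ℝ := (2 : ℝ) ^ ((n : ℝ) / (A : ℝ)) with hT
  have hT0 : 0 ≤ T := by positivity
  have hT1 : 1 ≤ T := hE7
  set z : Fin (k + 1) → ℕ := zf n with hzdef
  set Y : Fin k → ℝ := fun i => ((z i.castSucc : ℕ) : ℝ) ^ (2 + κ) with hY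
  set V : Fin k → ℝ := fun i => ((⌈2 * ((z i.castSucc : ℕ) : ℝ) ^ (2 + κ)⌉₊ : ℕ) : ℝ) with hV
  set I : Fin k → Finset ℕ := fun i => (Finset.Ioc ⌈2 * ((z i.castSucc : ℕ) : ℝ) ^ (2 + κ)⌉₊
      (min (z i.succ) ⌊(2 : ℝ) ^ ((n : ℝ) / 3)⌋₊)).filter Nat.Prime with hI
  have hz1 : ∀ i : Fin k, (1 : ℝ) ≤ z i.castSucc := fun i => hT1.trans (hlow i)
  have hY1 : ∀ i : Fin k, (1 : ℝ) ≤ Y i := fun i => Real.one_le_rpow (hz1 i) (by linarith)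
  have hzY : ∀ i : Fin k, ((z i.castSucc : ℕ) : ℝ) ≤ Y i := fun i =>
    Real.self_le_rpow_of_one_le (hz1 i) (by linarith)
  have hVY : ∀ i, 2 * Y i ≤ V i := fun i => Nat.le_ceil _
  have hV1 : ∀ i, 1 ≤ V i := fun i => by linarith [hVY i, hY1 i]
  have hIprop : ∀ i, ∀ r ∈ I i, r.Prime ∧ z i.castSucc < r ∧ r ≤ z i.succ ∧ V i < r := by
    intro i r hr
    simp only [hI, Finset.mem_filter, Finset.mem_Ioc] at hr
    obtain ⟨⟨hr1, hr2⟩, hrp⟩ := hr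
    refine ⟨hrp, ?_, (le_min_iff.mp hr2).1, by simp only [hV]; exact_mod_cast hr1⟩
    have : ((z i.castSucc : ℕ) : ℝ) < r := by
      have h1 : (⌈2 * ((z i.castSucc : ℕ) : ℝ) ^ (2 + κ)⌉₊ : ℝ) < r := by exact_mod_cast hr1
      have h2 : 2 * ((z i.castSucc : ℕ) : ℝ) ^ (2 + κ) ≤ ⌈2 * ((z i.castSucc : ℕ) : ℝ) ^ (2 + κ)⌉₊ :=
        Nat.le_ceil _
      linarith [hzY i, hY1 i]
    exact_mod_cast this
  -- hard-core measures on qualifying pieces: `LocalPieceHardness` + `stub_hardcore`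
  have hmeas : ∀ (i : Fin k) (β : ℕ),
      (pieceSet n (z i.castSucc) (z i.succ) ((1 + θ) ^ β) θ).Nonempty →
      T ≤ #(pieceSet n (z i.castSucc) (z i.succ) ((1 + θ) ^ β) θ) →
      Y i ≤ (1 + θ) ^ β → (1 + θ) ^ (β + 1) ≤ (2 : ℝ) ^ n →
      ∃ M : ℕ → ℝ, (∀ u, 0 ≤ M u ∧ M u ≤ 1) ∧
        δ * #(pieceSet n (z i.castSucc) (z i.succ) ((1 + θ) ^ β) θ) ≤
          ∑ u ∈ pieceSet n (z i.castSucc) (z i.succ) ((1 + θ) ^ β) θ, M u ∧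
        ∀ g' : (Fin n → Bool) → Bool, ACRealOver tcBasis g' (d + D) (p.eval n + q.eval n) →
          |∑ u ∈ pieceSet n (z i.castSucc) (z i.succ) ((1 + θ) ^ β) θ,
              M u * (if g' (bits n u) = lamBit u then (1 : ℝ) else -1)| ≤
            θ * ∑ u ∈ pieceSet n (z i.castSucc) (z i.succ) ((1 + θ) ^ β) θ, M u := by
    intro i β hne hTle hYle htop'
    refine stub_hardcore n (d + D) (p.eval n + q.eval n) K _ hne lamBit δ θ hδ0 hθ0 hK ?_
    intro g'' hg''
    have hg''T : g'' ∈ TCFun n (d + D + 1) (p'.eval n) := by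
      show ACRealOver tcBasis g'' (d + D + 1) (p'.eval n)
      rw [hp'eval]; exact hg''
    have hb : (1 + θ) ^ β * (1 + θ) ≤ (2 : ℝ) ^ n := by rw [← pow_succ]; exact htop'
    have := hLn (z i.castSucc) (z i.succ) ((1 + θ) ^ β) θ (hlow i) (hwide i) hYle hE3 hθ1 hb hTle
      g'' hg''T
    exact le_trans (mul_le_mul_of_nonneg_right hδδ₀ (Nat.cast_nonneg _)) this
  -- the fixed-`n` estimate
  have hmain := transfer_fixed n k k₁ (d + D) (p.eval n + q.eval n) rfl hk₁1 θ θ δ T hθ0 hθ1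
    hθ0.le hδ0 hδ1 z hmono htopn Y V hVY I hIprop C.eval hdil hmeas
  -- `#Bad` by Turán–Kubilius
  set Mtk : ℕ := ⌊(2 : ℝ) ^ ((n : ℝ) / 3)⌋₊ with hMtk
  have hIpm : ∀ i, ∀ r ∈ I i, r.Prime ∧ r ≤ Mtk := by
    intro i r hr
    simp only [hI, Finset.mem_filter, Finset.mem_Ioc] at hr
    exact ⟨hr.2, (le_min_iff.mp hr.1.2).2⟩
  have hbad := stub_pieces k n Mtk hk1 L₀ hL₀1 I hIpm hheavy
  have hbad' : (#((range (2 ^ n)).filter fun N =>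
      k ≤ 2 * #(univ.filter fun i : Fin k => ∀ p ∈ I i, ¬ p ∣ N)) : ℝ) ≤
      ε' / 16 * 2 ^ n + ε' / 16 * 2 ^ n := by
    refine hbad.trans (add_le_add ?_ ?_)
    · rw [hL₀def]
      have : 4 * (2 : ℝ) ^ n / (64 / ε') = ε' / 16 * 2 ^ n := by field_simp; ring
      rw [this]
    · have hM : (Mtk : ℝ) ≤ (2 : ℝ) ^ ((n : ℝ) / 3) := Nat.floor_le (by positivity)
      have hM2 : (Mtk : ℝ) ^ 2 ≤ (2 : ℝ) ^ (2 / 3 * (n : ℝ)) := by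
        calc (Mtk : ℝ) ^ 2 ≤ ((2 : ℝ) ^ ((n : ℝ) / 3)) ^ 2 := by gcongr
          _ = (2 : ℝ) ^ (2 / 3 * (n : ℝ)) := by
              rw [← Real.rpow_natCast, ← Real.rpow_mul (by norm_num)]; congr 1; push_cast; ring
      have hn2 : (1 : ℝ) ≤ (n : ℝ) + 2 := by linarith [(Nat.cast_nonneg n : (0 : ℝ) ≤ n)]
      have hL2 : (1 : ℝ) ≤ L₀ ^ 2 := one_le_pow₀ hL₀1
      calc 8 * (Mtk : ℝ) ^ 2 / L₀ ^ 2 ≤ 8 * (Mtk : ℝ) ^ 2 := div_le_self (by positivity) hL2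
        _ ≤ 8 * (2 : ℝ) ^ (2 / 3 * (n : ℝ)) := by gcongr
        _ ≤ 8 * 16 / ε' * ((n : ℝ) + 2) * (2 : ℝ) ^ (2 / 3 * (n : ℝ)) * (ε' / 16) := by
            have h0 : (0 : ℝ) ≤ (2 : ℝ) ^ (2 / 3 * (n : ℝ)) := by positivity
            have : 8 * (2 : ℝ) ^ (2 / 3 * (n : ℝ)) =
                8 * 16 / ε' * 1 * (2 : ℝ) ^ (2 / 3 * (n : ℝ)) * (ε' / 16) := by field_simp
            rw [this]; gcongr
        _ ≤ (2 : ℝ) ^ n * (ε' / 16) := mul_le_mul_of_nonneg_right hE5 (by positivity)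
        _ = ε' / 16 * 2 ^ n := by ring
  -- thin pieces
  have hthin : ∀ i : Fin k, (#((range (2 ^ n)).filter fun N => N ≠ 0 ∧
      V i < (locPart (z i.castSucc) (z i.succ) N : ℝ) ∧
      (#(pieceSet n (z i.castSucc) (z i.succ)
          ((1 + θ) ^ ⌊Real.log (locPart (z i.castSucc) (z i.succ) N) / Real.log (1 + θ)⌋₊) θ)
        : ℝ) < T) : ℝ) ≤ 2 * 2 ^ n / (θ * T) + T * (((n : ℝ) + 2) * (1 / Real.log (1 + θ) + 2)) := by
    intro i
    refine (stub_thin n k θ hθ0 hθ1 z i T (V i) hT0 (hV1 i)).trans ?_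
    have hVT : 2 * T ^ 2 ≤ V i := by
      have h1 : T ≤ z i.castSucc := hlow i
      have h2 : ((z i.castSucc : ℕ) : ℝ) ^ (2 : ℝ) ≤ Y i :=
        Real.rpow_le_rpow_of_exponent_le (hz1 i) (by linarith)
      have h3 : T ^ 2 ≤ ((z i.castSucc : ℕ) : ℝ) ^ (2 : ℝ) := by
        rw [Real.rpow_two]; gcongr
      linarith [hVY i]
    have hTpos : 0 < T := by linarith
    have hfirst : T * (4 * 2 ^ n / (θ * V i)) ≤ 2 * 2 ^ n / (θ * T) := by
      have hVpos : 0 < θ * V i := mul_pos hθ0 (by linarith [hV1 i])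
      rw [mul_div_assoc', div_le_div_iff₀ hVpos (by positivity)]
      have : T * (4 * (2 : ℝ) ^ n) * (θ * T) = 2 * 2 ^ n * (θ * (2 * T ^ 2)) := by ring
      rw [this]; gcongr
    have hsecond : T * (((n : ℝ) + 2) / Real.log (1 + θ) + 2) ≤
        T * (((n : ℝ) + 2) * (1 / Real.log (1 + θ) + 2)) := by
      apply mul_le_mul_of_nonneg_left _ hT0
      have hn2 : (1 : ℝ) ≤ (n : ℝ) + 2 := by linarith [(Nat.cast_nonneg n : (0 : ℝ) ≤ n)]
      have : ((n : ℝ) + 2) / Real.log (1 + θ) = ((n : ℝ) + 2) * (1 / Real.log (1 + θ)) := by ring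
      rw [this, mul_add]; gcongr; linarith
    calc T * (4 * 2 ^ n / (θ * V i) + ((n : ℝ) + 2) / Real.log (1 + θ) + 2)
        = T * (4 * 2 ^ n / (θ * V i)) + T * (((n : ℝ) + 2) / Real.log (1 + θ) + 2) := by ring
      _ ≤ _ := add_le_add hfirst hsecond
  have hthin_sum : ∑ i : Fin k, (#((range (2 ^ n)).filter fun N => N ≠ 0 ∧
      V i < (locPart (z i.castSucc) (z i.succ) N : ℝ) ∧
      (#(pieceSet n (z i.castSucc) (z i.succ)
          ((1 + θ) ^ ⌊Real.log (locPart (z i.castSucc) (z i.succ) N) / Real.log (1 + θ)⌋₊) θ)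
        : ℝ) < T) : ℝ) ≤ ε' / 16 * 2 ^ n + ε' / 16 * 2 ^ n := by
    calc _ ≤ ∑ _i : Fin k, (2 * 2 ^ n / (θ * T) + T * (((n : ℝ) + 2) * (1 / Real.log (1 + θ) + 2))) :=
          Finset.sum_le_sum fun i _ => hthin i
      _ = k * (2 * 2 ^ n / (θ * T)) + k * (T * (((n : ℝ) + 2) * (1 / Real.log (1 + θ) + 2))) := by
          rw [Finset.sum_const, Finset.card_univ, Fintype.card_fin, nsmul_eq_mul]; ring
      _ ≤ ε' / 16 * 2 ^ n + ε' / 16 * 2 ^ n := by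
          refine add_le_add ?_ ?_
          · -- `T ≥ 32k/(ε'θ)`
            have hTpos : 0 < T := by linarith
            rw [mul_div_assoc', div_le_iff₀ (by positivity)]
            have h1 : 32 * k / (ε' * θ) ≤ T := hE6a
            rw [div_le_iff₀ (by positivity)] at h1
            have h2n : (0 : ℝ) ≤ (2 : ℝ) ^ n / 16 := by positivity
            calc (k : ℝ) * (2 * 2 ^ n) = 2 ^ n / 16 * (32 * k) := by ring
              _ ≤ 2 ^ n / 16 * (T * (ε' * θ)) := mul_le_mul_of_nonneg_left h1 h2n
              _ = ε' / 16 * 2 ^ n * (θ * T) := by ring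
          · -- `T ≤ 2^(n/2)` and `ev_small`
            have hTle : T ≤ (2 : ℝ) ^ (1 / 2 * (n : ℝ)) := by
              rw [hT]
              apply Real.rpow_le_rpow_of_exponent_le (by norm_num)
              have hA0 : (0 : ℝ) < A := by exact_mod_cast (show 0 < A by omega)
              rw [div_le_iff₀ hA0]
              have hA2' : (2 : ℝ) ≤ A := by exact_mod_cast hA2
              have hn0 : (0 : ℝ) ≤ 1 / 2 * (n : ℝ) := by positivity
              calc (n : ℝ) = 1 / 2 * (n : ℝ) * 2 := by ring
                _ ≤ 1 / 2 * (n : ℝ) * A := mul_le_mul_of_nonneg_left hA2' hn0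
            have hc : 0 ≤ (k : ℝ) * (((n : ℝ) + 2) * (1 / Real.log (1 + θ) + 2)) := by positivity
            calc (k : ℝ) * (T * (((n : ℝ) + 2) * (1 / Real.log (1 + θ) + 2)))
                = (k * (((n : ℝ) + 2) * (1 / Real.log (1 + θ) + 2))) * T := by ring
              _ ≤ (k * (((n : ℝ) + 2) * (1 / Real.log (1 + θ) + 2))) * (2 : ℝ) ^ (1 / 2 * (n : ℝ)) :=
                  mul_le_mul_of_nonneg_left hTle hc
              _ = (16 * k * (1 / Real.log (1 + θ) + 2) / ε' * ((n : ℝ) + 2) *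
                    (2 : ℝ) ^ (1 / 2 * (n : ℝ))) * (ε' / 16) := by field_simp
              _ ≤ (2 : ℝ) ^ n * (ε' / 16) := mul_le_mul_of_nonneg_right hE6b (by positivity)
              _ = ε' / 16 * 2 ^ n := by ring
  -- total
  have htot : ((k : ℝ) * θ * 2 ^ n + 1) + (k * θ + (1 - δ) ^ k₁) * 2 ^ n +
      (#((range (2 ^ n)).filter fun N =>
          k ≤ 2 * #(univ.filter fun i : Fin k => ∀ p ∈ I i, ¬ p ∣ N)) : ℝ) +
      ∑ i : Fin k, (#((range (2 ^ n)).filter fun N => N ≠ 0 ∧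
          V i < (locPart (z i.castSucc) (z i.succ) N : ℝ) ∧
          (#(pieceSet n (z i.castSucc) (z i.succ)
              ((1 + θ) ^ ⌊Real.log (locPart (z i.castSucc) (z i.succ) N) / Real.log (1 + θ)⌋₊) θ)
            : ℝ) < T) : ℝ) ≤ ε * (2 : ℝ) ^ n := by
    have h2n : (0 : ℝ) ≤ (2 : ℝ) ^ n := by positivity
    have hA' : (k * θ + (1 - δ) ^ k₁) * (2 : ℝ) ^ n ≤ (ε' / 8 + ε' / 8) * 2 ^ n := by
      rw [hkθ]; gcongr
    have h1' : (k : ℝ) * θ * 2 ^ n + 1 ≤ ε' / 8 * 2 ^ n + ε' / 8 * 2 ^ n := by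
      rw [hkθ]; linarith
    calc _ ≤ (ε' / 8 * 2 ^ n + ε' / 8 * 2 ^ n) + (ε' / 8 + ε' / 8) * 2 ^ n +
          (ε' / 16 * 2 ^ n + ε' / 16 * 2 ^ n) + (ε' / 16 * 2 ^ n + ε' / 16 * 2 ^ n) :=
          add_le_add (add_le_add (add_le_add h1' hA') hbad') hthin_sum
      _ = (3 / 4 * ε') * 2 ^ n := by ring
      _ ≤ ε * 2 ^ n := by
          apply mul_le_mul_of_nonneg_right _ h2n
          linarith
  exact hmain.trans htot

end Summit.QuantumAdvantage.QuantumAdvantage.Theorems.LiouvilleOrthogonalTC0
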